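/-
Copyright (c) 2026 H21 harness. All rights reserved.
Released under Apache 2.0 license as described in the file LICENSE.
-/
import Summits.ResolutionOfSingularities.ResolutionOfSingularities.Theorems.FrobeniusClosingSteerHevLeafWords
import HarnessLib

/-!
# FrobeniusClosingSteerHevLeafSpine — the PROVED SPINE of the hEv leaf (companion of `…FrobeniusClosingSteerHevLeafWords`)

OURS (campaign `res-hironaka`, rung L ★L-G4, slot W4.1; pen res-L0-w41-idea-2 g12 on res-L0-w41-plan-1 RULING 164b/168b/170a; filed by
res-L0-w41-stub-4 g7 per RULING 172a). The audited text `L/res-L0-w41-idea-2/g12/HevLeafWords-cand.lean` sha16 81a3020beac68c24 (tri-3 R-AD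
decl-identity PASS ab845f7ac3821b08) contains three sorry-free theorems next to the words; the gate's 400-line rule for files with proofs forced a
mechanical split: the WORDS (every `def`, byte-identical) are `…FrobeniusClosingSteerHevLeafWords`, and the three theorems are here,
byte-identical, in the same namespace `…SwitchingDichotomy.HevLeaf`:

* `ternaryRankBudget_of` — [B]'s corollary: LEMMA 1 (`BinaryResidueBackward`) + LEMMA 2 (`TangentialNeedsBinary`) ⇒ `TernaryRankBudget`
  (pure bookkeeping);
* `strippingTailSwitchingEvenConclTwoN_of_pieces` — the spine: hEv ⟸ (∞1) transversal ∧ [B-run] ∧ [SS-run] ∧ (∞2) (pure logic);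
* `hEv_of_LBKE_of_seams` — the leaf modulo the two seam words `BinaryRunSeam`, `SatelliteSurfaceRunSeam`.

Replaces the role of NOTHING in the manuscript under review [claim: Hironaka2017, status: under-review]; the campaign's OWN words and glue;
AI review is weaker than expert review. No Theses import.
-/

set_option linter.dupNamespace false

open IsLocalRing
open Literature.AlgebraicGeometry.Resolution
open Summit.ResolutionOfSingularities.ResolutionOfSingularities.Theorems.SwitchingDichotomy.Words
open Summit.ResolutionOfSingularities.ResolutionOfSingularities.Theorems.SteerRankThinness (Concl HasProperCoarsening)
open Summit.ResolutionOfSingularities.ResolutionOfSingularities.Theorems.SwitchingDichotomy.ArithReduction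
  (OddCleanedPointStepAt)

namespace Summit.ResolutionOfSingularities.ResolutionOfSingularities.Theorems.SwitchingDichotomy.HevLeaf

section Window

variable {L : Type} [Field L]

/-- The corollary is pure logic from the two lemmas (kernel check of the budget's bookkeeping; gen-11 proof with `2 ≤ e`). -/
theorem ternaryRankBudget_of (h₁ : BinaryResidueBackward) (h₂ : TangentialNeedsBinary) : TernaryRankBudget := by
  intro L _ S _ hle f x e he hwin htan m
  obtain ⟨m', hm', ht⟩ := htan m
  have hb : BinaryResidueAt (S m') (f m') (2 * e) :=
    h₂ L (S m') (S (m' + 1)) (S (m' + 2)) (hle m') (hle (m' + 1)) (f m') (f (m' + 1)) (f (m' + 2))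
      (x m') (x (m' + 1)) e he (hwin m') (hwin (m' + 1)) ht
  obtain ⟨k, rfl⟩ := Nat.exists_eq_add_of_le hm'
  have back : ∀ k, BinaryResidueAt (S (m + k)) (f (m + k)) (2 * e) → BinaryResidueAt (S m) (f m) (2 * e) := by
    intro k
    induction k with
    | zero => intro h; simpa using h
    | succ k ih =>
      intro h
      exact ih (h₁ L (S (m + k)) (S (m + k + 1)) (hle (m + k)) (f (m + k)) (f (m + k + 1)) (x (m + k)) e he
        (hwin (m + k)) h)
  exact back k hb

end Window

section Run

variable {K : Type} [Field K]

/-- **THE SPINE (PROVED, pure logic): hEv ⟸ [T-run] ∧ [B-run] ∧ [L-run] ∧ [hEv-∞]** — excluded middle on (∞2) «satellite pairs infinitely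
often»: if not, [T-run] concludes; if so, [B-run] supplies (∞1), [L-run] supplies (∞3), and [hEv-∞] concludes. Offered to idea-3 as the body of
the leaf `hEv_of_LBKE` ([B-run] ⟸ KE + B, [L-run] ⟸ KE + L + LEMMA 2♯, [T-run] ⟸ run bookkeeping + 062). OURS. (folklore) -/
theorem strippingTailSwitchingEvenConclTwoN_of_pieces
    (hT : StrippingTailSwitchingEvenTransversalConclTwoN)
    (hB : StrippingTailSwitchingEvenBinaryTwoN)
    (hL : StrippingTailSwitchingEvenSatelliteSurfaceTwoN)
    (hInf : StrippingTailSwitchingEvenInfConclTwoN) :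
    StrippingTailSwitchingEvenConclTwoN := by
  intro p hp2 k K _ _ _ _ _ O A₀ h₀ t core hrk R P s hR0 hN hrun hnd hhigh h2 hinf hwild hsw hev
  by_cases hsat : ∀ i₀ : ℕ, ∃ i i' : ℕ, i₀ ≤ i ∧ IsSatellitePair R P i i'
  · exact hInf p hp2 k K O A₀ h₀ t core hrk R P s hR0 hN hrun hnd hhigh h2 hinf hwild hsw hev
      (hB p hp2 k K O A₀ h₀ t core hrk R P s hR0 hN hrun hnd hhigh h2 hinf hwild hsw hev hsat) hsat
      (hL p hp2 k K O A₀ h₀ t core hrk R P s hR0 hN hrun hnd hhigh h2 hinf hwild hsw hev)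
  · push Not at hsat
    exact hT p hp2 k K O A₀ h₀ t core hrk R P s hR0 hN hrun hnd hhigh h2 hinf hwild hsw hev hsat

end Run

section Seams

/-- **THE LEAF MODULO SEAMS `hEv_of_LBKE_of_seams`** : [T-run] → `BinaryRunSeam` → `SatelliteSurfaceRunSeam` → [L] → [B] → [K♭-E] → [hEv-∞] → hEv
(pure logic over the PROVED spine; the shape of strat-2's r45 feeder). OURS. (folklore) -/
theorem hEv_of_LBKE_of_seams (hT : (StrippingTailSwitchingEvenTransversalConclTwoN : Prop)) (hBs : BinaryRunSeam)
    (hLs : SatelliteSurfaceRunSeam) (hL : LWords) (hB : BWords) (hKE : StrippingTailSwitchingEvenWindowsTwoN)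
    (hInf : (StrippingTailSwitchingEvenInfConclTwoN : Prop)) : (StrippingTailSwitchingEvenConclTwoN : Prop) :=
  strippingTailSwitchingEvenConclTwoN_of_pieces hT (hBs hKE hB) (hLs hKE hL hB.2.2) hInf

end Seams

end Summit.ResolutionOfSingularities.ResolutionOfSingularities.Theorems.SwitchingDichotomy.HevLeaf
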